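import Literature.Analysis.FluidPDE.PressureFreeEpsilonRegularity
import Literature.Analysis.FluidPDE.CKNScalingExtras
import HarnessLib

/-!
# Kwon's pressure-free ε-regularity criterion: reduction to the cylinder `Q₂(0)`

Analysis/FluidPDE proof file (theorems only; no definitions, no named facts) on the discharge
path of the named fact `Literature.Analysis.FluidPDE.kwon2023_velocity_epsilon_regularity`
(`PressureFreeEpsilonRegularity.lean`; H. Kwon, *The role of the pressure in the regularity
theory for the Navier–Stokes equations*, J. Differential Equations (2023) = arXiv:2104.03160,
Thm. 1.4 with `r = m = 3`, for suitable weak solutions, "any suitable weak solution is a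
dissipative solution", §1 p. 3).

The fact is recorded at an arbitrary backward cylinder `Q_ρ(z₀)` "by the scaling
`u_λ(t,x) = λu(λ²t, λx)`, `p_λ = λ²p(λ²t, λx)` and translation" of the printed statement, which
lives on `Q₂ = (−4, 0) × B₂(0)` with conclusion on `Q_{1/2}` (§1, p. 1: "Due to the translation
and scale invariance of the Navier–Stokes equations, one can work on `Q_1` without loss of
generality"). This file PROVES that reduction in the tree's vocabulary:

* `stPreimage_parabolicCylinderOpens_two` — the parabolic zoom
  `Φ(s, y) = (t₀ + c² s, x₀ + c y)` with `c = ρ/2` pulls `Q_ρ(z₀)` back to `Q₂(0)`;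
* `kwon2023_velocity_epsilon_regularity_of_two` — **the printed form implies the fact**: if
  Thm. 1.4 (`r = m = 3`, qualitative conclusion) holds for suitable weak solutions on `Q₂(0)`
  in the classes of Def. 1.1, then `kwon2023_velocity_epsilon_regularity` holds, with the same
  `ε`. The zoomed pair `(c u ∘ Φ, c² p ∘ Φ)` is again a suitable weak solution with `ν = 1`,
  `f = 0` (`IsSuitableWeakSolutionOn.stRescale`); the classes `esssup_t r⁻¹∫|u|² < ∞`,
  `r⁻¹∬|∇u|² < ∞` (weak gradient `c² G ∘ Φ`, `HasWeakSpatialGradientOn.stRescale`),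
  `r⁻²∬|p|^{3/2} < ∞` and the smallness `r⁻²∬|u|³ ≤ ε` are scale invariant (`cknAEss_nsZoom`,
  `cknE_nsZoom`, `cknD_nsZoom`, `cknC_nsZoom`); and
  `‖c u ∘ Φ‖_{L^∞(Q_{1/2}(0))} = c ‖u‖_{L^∞(Q_{ρ/4}(z₀))}` (`eLpNorm_top_nsZoom`).

What remains for `kwon2023_velocity_epsilon_regularity_holds` is therefore exactly the printed
unit-scale theorem, whose proof (§2 Lemma 2.5: the decomposition `u = v + h` by the localized
Leray projection `−curl Δ⁻¹(φ curl ·)`; §3 Thm. 3.1: ε-regularity for the drift-perturbed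
system) is not yet in the tree.

## Mathlib / tree search

Reused: `IsSuitableWeakSolutionOn.stRescale` (`SuitableWeakRescaling`),
`HasWeakSpatialGradientOn.stRescale` (`SpaceTimeRescaling`), `cknAEss_nsZoom`, `cknC_nsZoom`,
`cknE_nsZoom`, `eLpNorm_top_nsZoom`, `LocalTypeIScaling.stAffine_preimage_parabolicCylinder`
(`LocalTypeIScaling`), `cknD_nsZoom` (`CKNScalingExtras`); the pattern of
`stPreimage_parabolicCylinderOpens_self` (`CKNInterpolationEstimate`) and of
`oneScaleRegularity_of_theorem15_3_force` (`CKNOneScaleFromRRS`). `lean search 'kwon2023'`: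
only the fact and its Summits dependent.

## References

* H. Kwon, J. Differential Equations (2023) = arXiv:2104.03160: Thm. 1.4 (p. 4), Def. 1.1 and
  §1 p. 3 (suitable ⇒ dissipative), §1 p. 1 and *Notations* p. 5 (scaling, translation,
  backward cylinders `Q_r = (t₀ − r², t₀) × B_r(x₀)`). [Kwon2023RolePressure]
* L. Caffarelli, R. Kohn, L. Nirenberg, Comm. Pure Appl. Math. 35 (1982), §2 (scaling of
  suitable weak solutions). [CaffarelliKohnNirenberg1982]
-/

noncomputable section

open MeasureTheory Set Function Filter Topology TopologicalSpace Metric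
open scoped NNReal ENNReal

namespace Literature.Analysis.FluidPDE

/-- The parabolic zoom `Φ(s, y) = (t₀ + c² s, x₀ + c y)` about `z₀ = (t₀, x₀)` with `c = ρ/2`
pulls the open cylinder `Q_ρ(z₀)` back to `Q₂(0)`: preimage form for the `Opens`. [folklore] -/
theorem stPreimage_parabolicCylinderOpens_two {ρ : ℝ} (hρ : 0 < ρ)
    (z₀ : ℝ × EuclideanSpace ℝ (Fin 3)) :
    stPreimage ((ρ / 2) ^ 2) (ρ / 2) z₀.1 z₀.2 (parabolicCylinderOpens ρ z₀) =
      parabolicCylinderOpens 2 0 := by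
  have hc : 0 < ρ / 2 := by positivity
  refine TopologicalSpace.Opens.ext ?_
  rw [coe_stPreimage, coe_parabolicCylinderOpens, coe_parabolicCylinderOpens]
  have hz : stAffine ((ρ / 2) ^ 2) (ρ / 2) z₀.1 z₀.2 (0 : ℝ × EuclideanSpace ℝ (Fin 3)) = z₀ :=
    Prod.ext (by simp [stAffine]) (by simp [stAffine])
  have h := LocalTypeIScaling.stAffine_preimage_parabolicCylinder hc z₀.1 z₀.2 2 0
  rwa [hz, show ρ / 2 * 2 = ρ by ring] at h

/-- **Kwon 2023, Thm. 1.4 (`r = m = 3`, suitable weak solutions): the printed form on `Q₂(0)`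
implies the fact at every cylinder `Q_ρ(z₀)`.** If there is `ε > 0` such that every suitable
weak solution `(u, p)` of Navier–Stokes (`ν = 1`, `f = 0`) on `Q₂(0) = (−4, 0) × B₂(0)` with
`esssup_t 2⁻¹∫_{B₂}|u|² < ∞`, a weak spatial gradient `G` with `2⁻¹∬_{Q₂}|G|² < ∞`,
`2⁻²∬_{Q₂}|p|^{3/2} < ∞` and `2⁻²∬_{Q₂}|u|³ ≤ ε` is essentially bounded on `Q_{1/2}(0)`, then
`kwon2023_velocity_epsilon_regularity` holds (with the same `ε`): zoom `Q_ρ(z₀)` to `Q₂(0)` by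
`u ↦ c u(t₀ + c² s, x₀ + c y)`, `p ↦ c² p(t₀ + c² s, x₀ + c y)`, `c = ρ/2`, under which
suitability, the three classes and the smallness are invariant, and transport the bound on
`Q_{1/2}(0)` back to `Q_{ρ/4}(z₀)` ("Due to the translation and scale invariance of the
Navier–Stokes equations, one can work on `Q_1` without loss of generality").
[cite: Kwon2023RolePressure, Thm. 1.4 with §1 p. 1 (scaling and translation)] -/
theorem kwon2023_velocity_epsilon_regularity_of_two
    (h : ∃ ε : ℝ, 0 < ε ∧
      ∀ (u : ℝ → EuclideanSpace ℝ (Fin 3) → EuclideanSpace ℝ (Fin 3))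
        (p : ℝ → EuclideanSpace ℝ (Fin 3) → ℝ),
      IsSuitableWeakSolutionOn
          (parabolicCylinderOpens 2 (0 : ℝ × EuclideanSpace ℝ (Fin 3))) 1 0 u p →
      cknAEss 2 (0 : ℝ × EuclideanSpace ℝ (Fin 3)) u < ⊤ →
      (∃ G : ℝ → EuclideanSpace ℝ (Fin 3) →
          EuclideanSpace ℝ (Fin 3) →L[ℝ] EuclideanSpace ℝ (Fin 3),
        HasWeakSpatialGradientOn
            (parabolicCylinderOpens 2 (0 : ℝ × EuclideanSpace ℝ (Fin 3))) u G ∧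
          cknE 2 (0 : ℝ × EuclideanSpace ℝ (Fin 3)) G < ⊤) →
      cknD 2 (0 : ℝ × EuclideanSpace ℝ (Fin 3)) p < ⊤ →
      cknC 2 (0 : ℝ × EuclideanSpace ℝ (Fin 3)) u ≤ ENNReal.ofReal ε →
      eLpNorm (uncurry u) ∞ (volume.restrict
        (parabolicCylinder (1 / 2) (0 : ℝ × EuclideanSpace ℝ (Fin 3)))) < ⊤) :
    kwon2023_velocity_epsilon_regularity := by
  obtain ⟨ε, hε, H⟩ := h
  refine ⟨ε, hε, fun u p z₀ ρ hρ hsol hA hG hD hC => ?_⟩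
  -- ### the zoom factor `c = ρ / 2`
  have hc : 0 < ρ / 2 := by positivity
  have hc2 : 0 < (ρ / 2) ^ 2 := by positivity
  have hz : stAffine ((ρ / 2) ^ 2) (ρ / 2) z₀.1 z₀.2 (0 : ℝ × EuclideanSpace ℝ (Fin 3)) = z₀ :=
    Prod.ext (by simp [stAffine]) (by simp [stAffine])
  have hcρ : ρ / 2 * 2 = ρ := by ring
  have hQ := stPreimage_parabolicCylinderOpens_two hρ z₀
  -- ### the zoomed pair on `Q₂(0)`
  set u' : ℝ → EuclideanSpace ℝ (Fin 3) → EuclideanSpace ℝ (Fin 3) :=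
    (ρ / 2) • stPull ((ρ / 2) ^ 2) (ρ / 2) z₀.1 z₀.2 u with hu'
  set p' : ℝ → EuclideanSpace ℝ (Fin 3) → ℝ :=
    (ρ / 2) ^ 2 • stPull ((ρ / 2) ^ 2) (ρ / 2) z₀.1 z₀.2 p with hp'
  have hsol' : IsSuitableWeakSolutionOn
      (parabolicCylinderOpens 2 (0 : ℝ × EuclideanSpace ℝ (Fin 3))) 1 0 u' p' := by
    have h1 := hsol.stRescale (α := ρ / 2) (β := (ρ / 2) ^ 2) (γ := ρ / 2) hc hc (by ring)
      z₀.1 z₀.2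
    have h0 : ((ρ / 2) ^ 2 * (ρ / 2)) • stPull ((ρ / 2) ^ 2) (ρ / 2) z₀.1 z₀.2
        (0 : ℝ → EuclideanSpace ℝ (Fin 3) → EuclideanSpace ℝ (Fin 3)) = 0 := by
      funext s y
      rw [smul_stPull_apply]
      simp
    rwa [show ρ / 2 * 1 / (ρ / 2) = 1 by field_simp, h0, hQ] at h1
  -- ### the classes and the smallness are scale invariant
  have hA' : cknAEss 2 (0 : ℝ × EuclideanSpace ℝ (Fin 3)) u' < ⊤ := by
    rw [hu', cknAEss_nsZoom hc two_pos z₀.1 z₀.2 0 u, hz, hcρ]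
    exact hA
  have hD' : cknD 2 (0 : ℝ × EuclideanSpace ℝ (Fin 3)) p' < ⊤ := by
    rw [hp', cknD_nsZoom hc two_pos z₀.1 z₀.2 0 p, hz, hcρ]
    exact hD
  have hC' : cknC 2 (0 : ℝ × EuclideanSpace ℝ (Fin 3)) u' ≤ ENNReal.ofReal ε := by
    rw [hu', cknC_nsZoom hc two_pos z₀.1 z₀.2 0 u, hz, hcρ]
    exact hC
  have hG' : ∃ G' : ℝ → EuclideanSpace ℝ (Fin 3) →
      EuclideanSpace ℝ (Fin 3) →L[ℝ] EuclideanSpace ℝ (Fin 3),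
      HasWeakSpatialGradientOn
          (parabolicCylinderOpens 2 (0 : ℝ × EuclideanSpace ℝ (Fin 3))) u' G' ∧
        cknE 2 (0 : ℝ × EuclideanSpace ℝ (Fin 3)) G' < ⊤ := by
    obtain ⟨G, hGw, hGE⟩ := hG
    refine ⟨(ρ / 2) ^ 2 • stPull ((ρ / 2) ^ 2) (ρ / 2) z₀.1 z₀.2 G, ?_, ?_⟩
    · have h1 := hGw.stRescale (ρ / 2) hc2 hc z₀.1 z₀.2
      rwa [hQ, show ρ / 2 * (ρ / 2) = (ρ / 2) ^ 2 by ring] at h1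
    · rw [cknE_nsZoom hc two_pos z₀.1 z₀.2 0 G, hz, hcρ]
      exact hGE
  -- ### Kwon's criterion on `Q₂(0)` and transport of the bound back to `Q_{ρ/4}(z₀)`
  have key := H u' p' hsol' hA' hG' hD' hC'
  have e := eLpNorm_top_nsZoom hc z₀.1 z₀.2 (1 / 2) 0 u
  rw [hz, show ρ / 2 * (1 / 2) = ρ / 4 by ring] at e
  rw [hu', e] at key
  rcases ENNReal.mul_lt_top_iff.1 key with ⟨-, h⟩ | h | h
  · exact h
  · exact absurd (ENNReal.ofReal_eq_zero.1 h) (not_le.2 hc)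
  · rw [h]
    exact ENNReal.zero_lt_top

end Literature.Analysis.FluidPDE

end
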